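import Literature.Geometry.PolyhedralFans.RelativeProjectiveRefinement
import HarnessLib

/-!
# Simultaneous star subdivisions at separated points, and the multi-point Lemma 2 of [KKMS]

Topic: `Literature/Geometry/PolyhedralFans` (continuation of `StarSubdivision`, `SupportFunction`,
`ProjectiveSubdivision`, `RelativeProjectiveRefinement`). G. Kempf, F. Knudsen, D. Mumford,
B. Saint-Donat, *Toroidal Embeddings I* (LNM 339, 1973), Ch. I §2, proof of Thm. 11, Lemma 2 (the
function `f_{x₀,ε} = f + ε g_{x₀}` on the star subdivision through `x₀`) and Ch. II §2 (the same
construction on a conical polyhedral COMPLEX, where the subdivision and the function must be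
compatible with all face identifications): when finitely many points `z ∈ Z` are SEPARATED by the
fan `Δ` (no cone of `Δ` contains two of them), the star subdivisions through the `z ∈ Z` act on
pairwise disjoint sets of cones, so that

* `Fan.mem_starIter_cones_iff_of_separated` — the iterated star subdivision `Δ.starIter l` through
  any duplicate-free enumeration `l` of `Z` has an explicitly described, ORDER-INDEPENDENT set of
  cones (`Fan.starIter_cones_eq_of_separated`): the cones of `Δ` meeting no `z`, and for each `z`
  the joins `τ + 𝕜_{≥0} z` of the cones `τ ∌ z` lying in a cone `∋ z`;
* `Fan.starCoord_starIter_of_separated` — the `z`-coordinate `starCoord z` of `Δ` is unchanged by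
  the star subdivisions through the other points;
* `Fan.SupportData.exists_multiStar` — **multi-point Lemma 2**: a strictly convex support function
  `f` on `Δ` yields, for every `M ≥ B` (one explicit bound), the strictly convex support function
  `M f + Σ_{z ∈ Z} starCoord_z` on the simultaneous star subdivision, with the SAME coefficient `1`
  at every `z` (sequential single-point steps `f ↦ M f + starCoord_z` give unequal coefficients,
  which is not acceptable when an automorphism of the situation permutes the `z`);
* `Fan.IsOrdFunction.multiStar` — the same for order functions of a subdivision `Δ` of `Δ₀`
  (all cones of `Δ₀` at once, one constant).

These are the fan-side tools for resolving log regular schemes presented by an ATLAS of charts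
(K. Kato, *Toric singularities*, Amer. J. Math. 116 (1994), (10.4), several charts: the
subdivision data must be invariant under the chart changes).

References: [KempfEtAl1973] Kempf–Knudsen–Mumford–Saint-Donat, Toroidal Embeddings I, LNM 339,
Ch. I §2 Thm. 11 proof (Lemma 2), Ch. II §2; [Fulton1993Toric] W. Fulton, Introduction to Toric
Varieties, §2.6 pp. 47–48; [Kato1994] K. Kato, Toric singularities, (10.4).
-/

noncomputable section

namespace Literature.Geometry.PolyhedralFans

open PointedCone Finset Matrix

variable {𝕜 : Type*} [Field 𝕜] [LinearOrder 𝕜] [IsStrictOrderedRing 𝕜]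

/-! ## Separated points: the star subdivisions commute -/

section Separated

variable {V : Type*} [AddCommGroup V] [Module 𝕜 V]

namespace Fan

variable {Δ : Fan 𝕜 V}

/-- A cone of the star subdivision through `z` which contains a point `z'` separated from `z`
(no cone of `Δ` contains both) is a cone of `Δ`. [cite: Fulton1993Toric, §2.6 p. 47] -/
theorem mem_cones_of_mem_starSubdivision_of_mem {z z' : V}
    (hzz' : ∀ σ ∈ Δ.cones, z ∈ σ → z' ∈ σ → False) {ρ : PointedCone 𝕜 V}
    (hρ : ρ ∈ (Δ.starSubdivision z).cones) (hz'ρ : z' ∈ ρ) : ρ ∈ Δ.cones := by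
  rw [starSubdivision_cones, mem_starCones_iff] at hρ
  rcases hρ with ⟨hρ, -⟩ | ⟨τ, -, -, ⟨σ, hσ, hτσ, hzσ⟩, rfl⟩
  · exact hρ
  · exact (hzz' σ hσ hzσ (sup_ray_le hτσ hzσ hz'ρ)).elim

/-- A cone of the star subdivision through `z` contained in a cone of `Δ` avoiding `z` is a cone
of `Δ`. [cite: Fulton1993Toric, §2.6 p. 47] -/
theorem mem_cones_of_mem_starSubdivision_of_le {z : V} {ρ σ : PointedCone 𝕜 V}
    (hρ : ρ ∈ (Δ.starSubdivision z).cones) (hσ : z ∉ σ) (hρσ : ρ ≤ σ) : ρ ∈ Δ.cones := by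
  rw [starSubdivision_cones, mem_starCones_iff] at hρ
  rcases hρ with ⟨hρ, -⟩ | ⟨τ, -, -, -, rfl⟩
  · exact hρ
  · exact (hσ (hρσ (self_mem_sup_ray τ z))).elim

/-- **The cones of an iterated star subdivision through SEPARATED points** (no cone of `Δ` contains
two distinct points of the list): the cones of `Δ` containing none of the points, together with,
for each point `z`, the joins `τ + 𝕜_{≥0} z` of the cones `τ ∌ z` of `Δ` lying in a cone of `Δ`
containing `z`. In particular the result does not depend on the order of the points ("the star
subdivisions at points in distinct cones commute"). [cite: Fulton1993Toric, §2.6 p. 47] -/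
theorem mem_starIter_cones_iff_of_separated :
    ∀ (l : List V) {Δ : Fan 𝕜 V}, l.Nodup →
      (∀ σ ∈ Δ.cones, ∀ z ∈ l, ∀ z' ∈ l, z ∈ σ → z' ∈ σ → z = z') →
      ∀ {ρ : PointedCone 𝕜 V}, ρ ∈ (Δ.starIter l).cones ↔
        (ρ ∈ Δ.cones ∧ ∀ z ∈ l, z ∉ ρ) ∨
          ∃ z ∈ l, ∃ τ ∈ Δ.cones, z ∉ τ ∧ (∃ σ ∈ Δ.cones, τ ≤ σ ∧ z ∈ σ) ∧ ρ = τ ⊔ ray 𝕜 z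
  | [], Δ, _, _, ρ => by simp
  | z :: l, Δ, hnd, hsep, ρ => by
    have hzl : z ∉ l := (List.nodup_cons.mp hnd).1
    have hnd' : l.Nodup := (List.nodup_cons.mp hnd).2
    -- no cone of `Δ` contains `z` and a point of `l`
    have hzz : ∀ z' ∈ l, ∀ σ ∈ Δ.cones, z ∈ σ → z' ∈ σ → False := by
      intro z' hz' σ hσ hz hz'σ
      have := hsep σ hσ z List.mem_cons_self z' (List.mem_cons_of_mem z hz') hz hz'σ
      exact hzl (this ▸ hz')
    -- the points of `l` stay separated in the star subdivision through `z`
    have hsep' : ∀ σ ∈ (Δ.starSubdivision z).cones, ∀ z₁ ∈ l, ∀ z₂ ∈ l,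
        z₁ ∈ σ → z₂ ∈ σ → z₁ = z₂ := by
      intro σ hσ z₁ hz₁ z₂ hz₂ h₁ h₂
      obtain ⟨σ₀, hσ₀, hle⟩ := starSubdivision_exists_le hσ
      exact hsep σ₀ hσ₀ z₁ (List.mem_cons_of_mem z hz₁) z₂ (List.mem_cons_of_mem z hz₂)
        (hle h₁) (hle h₂)
    rw [starIter_cons, mem_starIter_cones_iff_of_separated l hnd' hsep']
    constructor
    · rintro (⟨hρ, hlρ⟩ | ⟨z', hz', τ, hτ, hz'τ, ⟨σ, hσ, hτσ, hz'σ⟩, rfl⟩)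
      · -- `ρ` is a cone of the star subdivision through `z` meeting no point of `l`
        rw [starSubdivision_cones, mem_starCones_iff] at hρ
        rcases hρ with ⟨hρ, hzρ⟩ | ⟨τ, hτ, hzτ, hσ, rfl⟩
        · exact Or.inl ⟨hρ, fun w hw => by
            rcases List.mem_cons.mp hw with rfl | hw
            · exact hzρ
            · exact hlρ w hw⟩
        · exact Or.inr ⟨z, List.mem_cons_self, τ, hτ, hzτ, hσ, rfl⟩
      · -- `ρ = τ + ray z'` built in the star subdivision through `z`: all data are old
        have hσΔ : σ ∈ Δ.cones := mem_cones_of_mem_starSubdivision_of_mem (hzz z' hz') hσ hz'σ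
        have hzσ : z ∉ σ := fun h => hzz z' hz' σ hσΔ h hz'σ
        have hτΔ : τ ∈ Δ.cones := mem_cones_of_mem_starSubdivision_of_le hτ hzσ hτσ
        exact Or.inr ⟨z', List.mem_cons_of_mem z hz', τ, hτΔ, hz'τ, ⟨σ, hσΔ, hτσ, hz'σ⟩, rfl⟩
    · rintro (⟨hρ, hlρ⟩ | ⟨z', hz', τ, hτ, hz'τ, ⟨σ, hσ, hτσ, hz'σ⟩, rfl⟩)
      · exact Or.inl ⟨mem_starCones_of_not_mem hρ (hlρ z List.mem_cons_self),
          fun w hw => hlρ w (List.mem_cons_of_mem z hw)⟩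
      · rcases List.mem_cons.mp hz' with rfl | hz'
        · -- the point is `z` itself: a new cone of the first star subdivision
          refine Or.inl ⟨sup_ray_mem_starCones hτ hz'τ hσ hτσ hz'σ, fun w hw hwρ => ?_⟩
          exact hzz w hw σ hσ hz'σ (sup_ray_le hτσ hz'σ hwρ)
        · -- a later point: its data avoid `z`, hence survive the first star subdivision
          have hzσ : z ∉ σ := fun h => hzz z' hz' σ hσ h hz'σ
          have hzτ : z ∉ τ := fun h => hzσ (hτσ h)
          exact Or.inr ⟨z', hz', τ, mem_starCones_of_not_mem hτ hzτ, hz'τ,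
            ⟨σ, mem_starCones_of_not_mem hσ hzσ, hτσ, hz'σ⟩, rfl⟩

/-- **Star subdivisions through separated points commute**: two duplicate-free enumerations of
the same separated set of points give iterated star subdivisions with the same cones.
[cite: Fulton1993Toric, §2.6 p. 47] -/
theorem starIter_cones_eq_of_separated {l₁ l₂ : List V} (h₁ : l₁.Nodup) (h₂ : l₂.Nodup)
    (hl : ∀ z, z ∈ l₁ ↔ z ∈ l₂)
    (hsep : ∀ σ ∈ Δ.cones, ∀ z ∈ l₁, ∀ z' ∈ l₁, z ∈ σ → z' ∈ σ → z = z') :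
    (Δ.starIter l₁).cones = (Δ.starIter l₂).cones := by
  have hsep₂ : ∀ σ ∈ Δ.cones, ∀ z ∈ l₂, ∀ z' ∈ l₂, z ∈ σ → z' ∈ σ → z = z' :=
    fun σ hσ z hz z' hz' => hsep σ hσ z ((hl z).2 hz) z' ((hl z').2 hz')
  ext ρ
  rw [mem_starIter_cones_iff_of_separated l₁ h₁ hsep, mem_starIter_cones_iff_of_separated l₂ h₂ hsep₂]
  simp only [hl]

/-- Every cone of the iterated star subdivision lies in a cone of `Δ`.
[cite: Fulton1993Toric, §2.6 p. 47] -/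
theorem starIter_exists_le : ∀ (l : List V) {Δ : Fan 𝕜 V} {ρ : PointedCone 𝕜 V},
    ρ ∈ (Δ.starIter l).cones → ∃ σ ∈ Δ.cones, ρ ≤ σ
  | [], _, ρ, hρ => ⟨ρ, hρ, le_rfl⟩
  | z :: l, Δ, ρ, hρ => by
    rw [starIter_cons] at hρ
    obtain ⟨σ, hσ, hρσ⟩ := starIter_exists_le l hρ
    obtain ⟨σ₀, hσ₀, hσσ₀⟩ := starSubdivision_exists_le hσ
    exact ⟨σ₀, hσ₀, hρσ.trans hσσ₀⟩

end Fan

end Separated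

/-! ## The `z`-coordinates are unchanged by the other star subdivisions -/

section Coordinates

variable {κ : Type*}

namespace Fan

variable {Δ : Fan 𝕜 (κ → 𝕜)}

/-- Star decompositions with respect to `z'` are the same in `Δ` and in the star subdivision of `Δ`
through a point `z` separated from `z'`. [cite: KempfEtAl1973, I §2 Thm. 11 proof, Lemma 2 (b)] -/
theorem isStarDecomp_starSubdivision_iff {z z' : κ → 𝕜}
    (hzz' : ∀ σ ∈ Δ.cones, z ∈ σ → z' ∈ σ → False) {x : κ → 𝕜} {c : 𝕜} :
    (Δ.starSubdivision z).IsStarDecomp z' x c ↔ Δ.IsStarDecomp z' x c := by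
  constructor
  · rintro ⟨σ, hσ, hz'σ, τ, hτ, hz'τ, hτσ, t, ht, hc, hx⟩
    have hσΔ : σ ∈ Δ.cones := mem_cones_of_mem_starSubdivision_of_mem hzz' hσ hz'σ
    have hzσ : z ∉ σ := fun h => hzz' σ hσΔ h hz'σ
    exact ⟨σ, hσΔ, hz'σ, τ, mem_cones_of_mem_starSubdivision_of_le hτ hzσ hτσ, hz'τ, hτσ, t, ht,
      hc, hx⟩
  · rintro ⟨σ, hσ, hz'σ, τ, hτ, hz'τ, hτσ, t, ht, hc, hx⟩
    have hzσ : z ∉ σ := fun h => hzz' σ hσ h hz'σ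
    exact ⟨σ, mem_starCones_of_not_mem hσ hzσ, hz'σ, τ,
      mem_starCones_of_not_mem hτ fun h => hzσ (hτσ h), hz'τ, hτσ, t, ht, hc, hx⟩

/-- The `z'`-coordinate is unchanged by the star subdivision through a point `z` separated from
`z'`. [cite: KempfEtAl1973, I §2 Thm. 11 proof, Lemma 2 (b)] -/
theorem starCoord_starSubdivision_of_separated {z z' : κ → 𝕜}
    (hzz' : ∀ σ ∈ Δ.cones, z ∈ σ → z' ∈ σ → False) (x : κ → 𝕜) :
    (Δ.starSubdivision z).starCoord z' x = Δ.starCoord z' x := by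
  by_cases hex : ∃ c, Δ.IsStarDecomp z' x c
  · obtain ⟨c, hc⟩ := hex
    rw [starCoord_eq_of_isStarDecomp hc,
      starCoord_eq_of_isStarDecomp ((isStarDecomp_starSubdivision_iff hzz').2 hc)]
  · have hex' : ¬ ∃ c, (Δ.starSubdivision z).IsStarDecomp z' x c := by
      rintro ⟨c, hc⟩; exact hex ⟨c, (isStarDecomp_starSubdivision_iff hzz').1 hc⟩
    rw [starCoord, dif_neg hex', starCoord, dif_neg hex]

/-- **The `z'`-coordinate of `Δ` survives all star subdivisions through points separated from
`z'`** (and not equal to it). [cite: KempfEtAl1973, I §2 Thm. 11 proof, Lemma 2 (b)] -/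
theorem starCoord_starIter_of_separated :
    ∀ (l : List (κ → 𝕜)) {Δ : Fan 𝕜 (κ → 𝕜)} {z' : κ → 𝕜}, z' ∉ l →
      (∀ σ ∈ Δ.cones, ∀ z ∈ l, z ∈ σ → z' ∈ σ → False) →
      ∀ x, (Δ.starIter l).starCoord z' x = Δ.starCoord z' x
  | [], _, _, _, _, _ => rfl
  | z :: l, Δ, z', hz'l, hsep, x => by
    rw [starIter_cons]
    have hzz' : ∀ σ ∈ Δ.cones, z ∈ σ → z' ∈ σ → False :=
      fun σ hσ => hsep σ hσ z List.mem_cons_self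
    have hsep' : ∀ σ ∈ (Δ.starSubdivision z).cones, ∀ w ∈ l, w ∈ σ → z' ∈ σ → False := by
      intro σ hσ w hw hwσ hz'σ
      obtain ⟨σ₀, hσ₀, hle⟩ := starSubdivision_exists_le hσ
      exact hsep σ₀ hσ₀ w (List.mem_cons_of_mem z hw) (hle hwσ) (hle hz'σ)
    rw [starCoord_starIter_of_separated l (fun h => hz'l (List.mem_cons_of_mem z h)) hsep' x,
      starCoord_starSubdivision_of_separated hzz' x]

/-- On a cone of `Δ` the sum of the `z`-coordinates over a separated `Z` reduces to the coordinate
of the unique point of `Z` in that cone (all other coordinates vanish there).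
[cite: KempfEtAl1973, I §2 Thm. 11 proof, Lemma 2 (b)] -/
theorem sum_starCoord_eq_of_mem {Z : Finset (κ → 𝕜)} {η : PointedCone 𝕜 (κ → 𝕜)} (hη : η ∈ Δ.cones)
    {v : κ → 𝕜} (hv : v ∈ Z) (huniq : ∀ z' ∈ Z, z' ∈ η → z' = v) {x : κ → 𝕜} (hx : x ∈ η) :
    ∑ z ∈ Z, Δ.starCoord z x = Δ.starCoord v x := by
  classical
  rw [← Finset.sum_erase_add _ _ hv]
  have h0 : ∑ z ∈ Z.erase v, Δ.starCoord z x = 0 := by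
    refine Finset.sum_eq_zero fun z hz => ?_
    have hzv : z ≠ v := (Finset.mem_erase.mp hz).1
    have hzη : z ∉ η := fun h => hzv (huniq z (Finset.mem_erase.mp hz).2 h)
    exact Fan.starCoord_of_not_mem hη hzη hx
  rw [h0, zero_add]

end Fan

end Coordinates

/-! ## The support of an iterated star subdivision -/

section SupportIter

variable {κ : Type*} [Fintype κ]

namespace Fan

/-- Iterated star subdivisions through nonzero vectors do not change the support.
[cite: Fulton1993Toric, §2.6 p. 47] -/
theorem starIter_support_eq : ∀ (l : List (κ → 𝕜)) {Δ : Fan 𝕜 (κ → 𝕜)}, (∀ z ∈ l, z ≠ 0) →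
    (Δ.starIter l).support = Δ.support
  | [], _, _ => rfl
  | z :: l, Δ, hl => by
    rw [starIter_cons, starIter_support_eq l fun w hw => hl w (List.mem_cons_of_mem z hw),
      starSubdivision_support (hl z List.mem_cons_self)]

omit [Fintype κ] in
/-- Iterated star subdivisions only depend on the set of cones. [cite: Fulton1993Toric, §2.6 p. 47] -/
theorem starIter_cones_congr : ∀ (l : List (κ → 𝕜)) {Δ₁ Δ₂ : Fan 𝕜 (κ → 𝕜)},
    Δ₁.cones = Δ₂.cones → (Δ₁.starIter l).cones = (Δ₂.starIter l).cones
  | [], _, _, h => h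
  | z :: l, Δ₁, Δ₂, h => by
    rw [starIter_cons, starIter_cons]
    refine starIter_cones_congr l ?_
    rw [starSubdivision_cones, starSubdivision_cones]
    simp only [starCones, h]

/-- Restriction to a cone commutes with iterated star subdivisions through nonzero vectors (when
the restricted fan covers the cone). [cite: Fulton1993Toric, §2.6 p. 47] -/
theorem restrict_starIter_cones : ∀ (l : List (κ → 𝕜)) {Δ : Fan 𝕜 (κ → 𝕜)}
    {σ : PointedCone 𝕜 (κ → 𝕜)}, (∀ z ∈ l, z ≠ 0) →
    (σ : Set (κ → 𝕜)) ⊆ (Δ.restrict σ).support →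
    ((Δ.starIter l).restrict σ).cones = ((Δ.restrict σ).starIter l).cones
  | [], _, _, _, _ => rfl
  | z :: l, Δ, σ, hl, hsupp => by
    have hz0 : z ≠ 0 := hl z List.mem_cons_self
    have hcones : ((Δ.starSubdivision z).restrict σ).cones = ((Δ.restrict σ).starSubdivision z).cones :=
      restrict_starSubdivision_cones hsupp
    have hsupp' : (σ : Set (κ → 𝕜)) ⊆ ((Δ.starSubdivision z).restrict σ).support := by
      rw [support_congr hcones, starSubdivision_support hz0]; exact hsupp
    rw [starIter_cons, starIter_cons,
      restrict_starIter_cones l (fun w hw => hl w (List.mem_cons_of_mem z hw)) hsupp']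
    -- the two iterated subdivisions start from fans with the same cones
    exact starIter_cones_congr l hcones

end Fan

end SupportIter

/-! ## The multi-point Lemma 2 -/

section MultiPoint

variable {κ : Type*} [Fintype κ]

namespace Fan.SupportData

variable {Δ : Fan 𝕜 (κ → 𝕜)} (D : Δ.SupportData)

/-- **Step choices for the simultaneous star subdivision.** For a cone `ρ` of the iterated star
subdivision through the separated points `Z` there are a point `v ∈ Z` and single-point step
choices (`StepChoice`: base, anchor) for `ρ` relative to `v` such that `v` is the ONLY point of
`Z` in the anchor's linearity domain, and the new linearity domain is a cone of the iterated
subdivision. [cite: KempfEtAl1973, I §2 Thm. 11 proof, Lemma 2] -/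
theorem exists_multiStepChoice {Z : Finset (κ → 𝕜)} (hZne : Z.Nonempty) {l : List (κ → 𝕜)}
    (hl : l.Nodup) (hlZ : ∀ z, z ∈ l ↔ z ∈ Z)
    (hsep : ∀ σ ∈ Δ.cones, ∀ z ∈ Z, ∀ z' ∈ Z, z ∈ σ → z' ∈ σ → z = z')
    {ρ : PointedCone 𝕜 (κ → 𝕜)} (hρ : ρ ∈ (Δ.starIter l).cones) :
    ∃ v ∈ Z, ∃ S : StepChoice D v ρ, (∀ z' ∈ Z, z' ∈ D.domain S.anchor → z' = v) ∧
      S.newDomain ∈ (Δ.starIter l).cones := by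
  classical
  have hsepl : ∀ σ ∈ Δ.cones, ∀ z ∈ l, ∀ z' ∈ l, z ∈ σ → z' ∈ σ → z = z' :=
    fun σ hσ z hz z' hz' => hsep σ hσ z ((hlZ z).1 hz) z' ((hlZ z').1 hz')
  have hiff := fun {ρ : PointedCone 𝕜 (κ → 𝕜)} =>
    Fan.mem_starIter_cones_iff_of_separated l (Δ := Δ) hl hsepl (ρ := ρ)
  rcases hiff.1 hρ with ⟨hρΔ, hno⟩ | ⟨z, hz, τ, hτ, hzτ, ⟨σ, hσ, hτσ, hzσ⟩, rfl⟩
  · have hdom := D.domain_mem hρΔ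
    by_cases hex : ∃ z ∈ Z, z ∈ D.domain ρ
    · obtain ⟨z, hz, hzd⟩ := hex
      have hzρ : z ∉ ρ := hno z ((hlZ z).2 hz)
      let S : StepChoice D z ρ :=
        ⟨ρ, ρ, hρΔ, hzρ, hρΔ, D.le_domain hρΔ, le_sup_left, fun _ => D.le_domain hρΔ⟩
      refine ⟨z, hz, S, fun z' hz' hz'd => hsep _ hdom z' hz' z hz hz'd hzd, ?_⟩
      have hN : S.newDomain = ρ ⊔ ray 𝕜 z := by
        rw [StepChoice.newDomain, if_pos hzd]
      rw [hN]
      exact hiff.2 (Or.inr ⟨z, (hlZ z).2 hz, ρ, hρΔ, hzρ, ⟨D.domain ρ, hdom, D.le_domain hρΔ, hzd⟩,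
        rfl⟩)
    · obtain ⟨z₀, hz₀⟩ := hZne
      have hz₀ρ : z₀ ∉ ρ := hno z₀ ((hlZ z₀).2 hz₀)
      let S : StepChoice D z₀ ρ :=
        ⟨ρ, ρ, hρΔ, hz₀ρ, hρΔ, D.le_domain hρΔ, le_sup_left, fun _ => D.le_domain hρΔ⟩
      have hz₀d : z₀ ∉ D.domain ρ := fun h => hex ⟨z₀, hz₀, h⟩
      refine ⟨z₀, hz₀, S, fun z' hz' hz'd => (hex ⟨z', hz', hz'd⟩).elim, ?_⟩
      have hN : S.newDomain = D.domain ρ := by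
        rw [StepChoice.newDomain, if_neg hz₀d]
      rw [hN]
      exact hiff.2 (Or.inl ⟨hdom, fun w hw hwd => hex ⟨w, (hlZ w).1 hw, hwd⟩⟩)
  · have hzZ : z ∈ Z := (hlZ z).1 hz
    have hdom := D.domain_mem hσ
    have hzd : z ∈ D.domain σ := D.le_domain hσ hzσ
    let S : StepChoice D z (τ ⊔ ray 𝕜 z) :=
      ⟨τ, σ, hτ, hzτ, hσ, hτσ.trans (D.le_domain hσ), le_rfl, fun h => absurd hzd h⟩
    refine ⟨z, hzZ, S, fun z' hz' hz'd => hsep _ hdom z' hz' z hzZ hz'd hzd, ?_⟩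
    have hN : S.newDomain = τ ⊔ ray 𝕜 z := by
      rw [StepChoice.newDomain, if_pos hzd]
    rw [hN]
    exact hρ

/-- **[KempfEtAl1973] I §2 Lemma 2, MULTI-POINT form.** Let `D` be a strictly convex support
function on the fan `Δ` and `Z` a finite set of nonzero vectors which are SEPARATED by `Δ` (no
cone of `Δ` contains two of them). There is a bound `B > 0` such that for every `M ≥ B` and every
duplicate-free enumeration `l` of `Z`, the function `M f + Σ_{z ∈ Z} starCoord_z` — with the SAME
coefficient at every point — is a strictly convex support function on the simultaneous star
subdivision `Δ.starIter l` (its pieces are `M a_σ + ℓ`, `ℓ` the exposing functional of the base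
face in the linearity domain of `a_σ`, normalised at the unique point of `Z` in that domain; on
each old linearity domain the multi-point function coincides with a single-point one, and one
constant `M` dominates all the finitely many generator ratios).
[cite: KempfEtAl1973, I §2 Thm. 11 proof, Lemma 2] -/
theorem exists_multiStar {Z : Finset (κ → 𝕜)} (hZ0 : ∀ z ∈ Z, z ≠ 0)
    (hsep : ∀ σ ∈ Δ.cones, ∀ z ∈ Z, ∀ z' ∈ Z, z ∈ σ → z' ∈ σ → z = z') :
    ∃ B : 𝕜, 0 < B ∧ ∀ M : 𝕜, B ≤ M → ∀ l : List (κ → 𝕜), l.Nodup → (∀ z, z ∈ l ↔ z ∈ Z) →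
      ∃ D' : (Δ.starIter l).SupportData, D'.f = fun x => M * D.f x + ∑ z ∈ Z, Δ.starCoord z x := by
  classical
  -- the degenerate case `Z = ∅`
  rcases Z.eq_empty_or_nonempty with rfl | hZne
  · refine ⟨1, one_pos, fun M hM l hl hlZ => ?_⟩
    have hl0 : l = [] := List.eq_nil_iff_forall_not_mem.mpr fun z hz => by simpa using (hlZ z).1 hz
    subst hl0
    refine ⟨(D.scale M (lt_of_lt_of_le one_pos hM)).copyF
      (fun x => M * D.f x + ∑ z ∈ (∅ : Finset (κ → 𝕜)), Δ.starCoord z x) fun x _ => ?_, rfl⟩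
    rw [Finset.sum_empty, add_zero]; rfl
  -- a reference enumeration; the cones do not depend on the enumeration
  set l₀ := Z.toList with hl₀
  have hl₀nd : l₀.Nodup := Finset.nodup_toList Z
  have hl₀Z : ∀ z, z ∈ l₀ ↔ z ∈ Z := fun z => Finset.mem_toList
  have hl₀0 : ∀ z ∈ l₀, z ≠ 0 := fun z hz => hZ0 z ((hl₀Z z).1 hz)
  set Γ := Δ.starIter l₀ with hΓ
  have hsupp : Γ.support = Δ.support := Fan.starIter_support_eq l₀ hl₀0
  -- step choices
  have hch : ∀ ρ, ρ ∈ Γ.cones → ∃ v, v ∈ Z ∧ ∃ S : StepChoice D v ρ,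
      (∀ z' ∈ Z, z' ∈ D.domain S.anchor → z' = v) ∧ S.newDomain ∈ Γ.cones := by
    intro ρ hρ
    obtain ⟨v, hv, S, h1, h2⟩ := D.exists_multiStepChoice hZne hl₀nd hl₀Z hsep hρ
    exact ⟨v, hv, S, h1, h2⟩
  choose v hvZ S huniq hnew using hch
  have hv0 : ∀ ρ (hρ : ρ ∈ Γ.cones), v ρ hρ ≠ 0 := fun ρ hρ => hZ0 _ (hvZ ρ hρ)
  -- the multi-point function and pieces
  set sc : (κ → 𝕜) → 𝕜 := fun x => ∑ z ∈ Z, Δ.starCoord z x with hsc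
  have hsc_loc : ∀ ρ (hρ : ρ ∈ Γ.cones) {x : κ → 𝕜}, x ∈ D.domain (S ρ hρ).anchor →
      sc x = Δ.starCoord (v ρ hρ) x := fun ρ hρ x hx =>
    sum_starCoord_eq_of_mem (D.domain_mem (S ρ hρ).anchor_mem) (hvZ ρ hρ) (huniq ρ hρ) hx
  -- local computation (any `M`)
  have hloc : ∀ (M : 𝕜) ρ (hρ : ρ ∈ Γ.cones) {x : κ → 𝕜}, x ∈ D.domain (S ρ hρ).anchor →
      M * D.f x + sc x ≤ (M • D.piece (S ρ hρ).anchor + (S ρ hρ).expose) ⬝ᵥ x ∧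
        (M * D.f x + sc x = (M • D.piece (S ρ hρ).anchor + (S ρ hρ).expose) ⬝ᵥ x ↔
          x ∈ (S ρ hρ).newDomain) := by
    intro M ρ hρ x hx
    rw [hsc_loc ρ hρ hx]
    exact (S ρ hρ).local_le (hv0 ρ hρ) M hx
  -- linearity on the cones (any `M`)
  have hlin : ∀ (M : 𝕜) ρ (hρ : ρ ∈ Γ.cones) {y : κ → 𝕜}, y ∈ ρ →
      M * D.f y + sc y = (M • D.piece (S ρ hρ).anchor + (S ρ hρ).expose) ⬝ᵥ y := by
    intro M ρ hρ y hy
    have hyN : y ∈ (S ρ hρ).newDomain := (S ρ hρ).le_newDomain hy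
    exact ((hloc M ρ hρ ((S ρ hρ).newDomain_le hyN)).2).mpr hyN
  -- generators and the bound
  set G : Finset (κ → 𝕜) := Γ.finite.toFinset.biUnion gens with hG
  have hGsupp : ∀ g ∈ G, g ∈ Δ.support := by
    intro g hg
    obtain ⟨ρ', hρ', hg'⟩ := Finset.mem_biUnion.mp hg
    have hρ'c : ρ' ∈ Γ.cones := Γ.finite.mem_toFinset.mp hρ'
    rw [← hsupp]
    exact Fan.mem_support.mpr ⟨ρ', hρ'c, gens_subset (Γ.fg hρ'c) hg'⟩
  set ratio : PointedCone 𝕜 (κ → 𝕜) → (κ → 𝕜) → 𝕜 := fun ρ g =>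
    if hρ : ρ ∈ Γ.cones then
      (sc g - (S ρ hρ).expose ⬝ᵥ g) / (D.piece (S ρ hρ).anchor ⬝ᵥ g - D.f g)
    else 0 with hratio
  set B : 𝕜 := 1 + ∑ ρ ∈ Γ.finite.toFinset, ∑ g ∈ G, |ratio ρ g| with hB
  have hBpos : 0 < B := by
    have : 0 ≤ ∑ ρ ∈ Γ.finite.toFinset, ∑ g ∈ G, |ratio ρ g| :=
      Finset.sum_nonneg fun _ _ => Finset.sum_nonneg fun _ _ => abs_nonneg _
    rw [hB]; linarith
  have hratio_lt : ∀ ρ (hρ : ρ ∈ Γ.cones), ∀ g ∈ G, |ratio ρ g| < B := by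
    intro ρ hρ g hg
    have h1 : |ratio ρ g| ≤ ∑ g' ∈ G, |ratio ρ g'| :=
      Finset.single_le_sum (f := fun g' => |ratio ρ g'|) (fun _ _ => abs_nonneg _) hg
    have h2 : ∑ g' ∈ G, |ratio ρ g'| ≤ ∑ ρ' ∈ Γ.finite.toFinset, ∑ g' ∈ G, |ratio ρ' g'| :=
      Finset.single_le_sum (f := fun ρ' => ∑ g' ∈ G, |ratio ρ' g'|)
        (fun _ _ => Finset.sum_nonneg fun _ _ => abs_nonneg _) (Γ.finite.mem_toFinset.mpr hρ)
    rw [hB]; linarith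
  refine ⟨B, hBpos, fun M hM l hl hlZ => ?_⟩
  -- comparison at generators
  have hgen : ∀ ρ (hρ : ρ ∈ Γ.cones), ∀ g ∈ G,
      M * D.f g + sc g ≤ (M • D.piece (S ρ hρ).anchor + (S ρ hρ).expose) ⬝ᵥ g ∧
        (g ∉ D.domain (S ρ hρ).anchor →
          M * D.f g + sc g < (M • D.piece (S ρ hρ).anchor + (S ρ hρ).expose) ⬝ᵥ g) := by
    intro ρ hρ g hg
    by_cases hgD : g ∈ D.domain (S ρ hρ).anchor
    · exact ⟨(hloc M ρ hρ hgD).1, fun h => absurd hgD h⟩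
    · have hlt : M * D.f g + sc g < (M • D.piece (S ρ hρ).anchor + (S ρ hρ).expose) ⬝ᵥ g := by
        set d := D.piece (S ρ hρ).anchor ⬝ᵥ g - D.f g with hd
        have hdpos : 0 < d := by
          have := D.lt_piece_of_not_mem_domain (S ρ hρ).anchor_mem (hGsupp g hg) hgD
          rw [hd]; linarith
        have hr : sc g - (S ρ hρ).expose ⬝ᵥ g = ratio ρ g * d := by
          rw [hratio]; simp only [dif_pos hρ]; rw [← hd, div_mul_cancel₀ _ hdpos.ne']
        have h1 : ratio ρ g * d ≤ |ratio ρ g| * d :=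
          mul_le_mul_of_nonneg_right (le_abs_self _) hdpos.le
        have h2 : |ratio ρ g| * d < B * d := mul_lt_mul_of_pos_right (hratio_lt ρ hρ g hg) hdpos
        have h3 : B * d ≤ M * d := mul_le_mul_of_nonneg_right hM hdpos.le
        rw [add_dotProduct, smul_dotProduct, smul_eq_mul]
        have h4 : sc g - (S ρ hρ).expose ⬝ᵥ g < M * d := by rw [hr]; linarith
        rw [hd] at h4
        linarith
      exact ⟨hlt.le, fun _ => hlt⟩
  -- global comparison on the support
  have hglob : ∀ ρ (hρ : ρ ∈ Γ.cones) {x : κ → 𝕜}, x ∈ Γ.support →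
      M * D.f x + sc x ≤ (M • D.piece (S ρ hρ).anchor + (S ρ hρ).expose) ⬝ᵥ x ∧
        (M * D.f x + sc x = (M • D.piece (S ρ hρ).anchor + (S ρ hρ).expose) ⬝ᵥ x ↔
          x ∈ (S ρ hρ).newDomain) := by
    intro ρ hρ x hx
    set P := M • D.piece (S ρ hρ).anchor + (S ρ hρ).expose with hP
    obtain ⟨ρ', hρ', hxρ'⟩ := Fan.mem_support.mp hx
    have hfg' : ρ'.FG := Γ.fg hρ'
    have hxh : x ∈ PointedCone.hull 𝕜 ((gens ρ' : Finset (κ → 𝕜)) : Set (κ → 𝕜)) := by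
      rw [hull_gens hfg']; exact hxρ'
    obtain ⟨c, hc, hcx⟩ := mem_hull_finset_iff.mp hxh
    have hgG : ∀ g ∈ gens ρ', g ∈ G := fun g hg =>
      Finset.mem_biUnion.mpr ⟨ρ', Γ.finite.mem_toFinset.mpr hρ', hg⟩
    -- the function is linear on `ρ'`
    set P' := M • D.piece (S ρ' hρ').anchor + (S ρ' hρ').expose with hP'
    have hlin' : ∀ y ∈ ρ', M * D.f y + sc y = P' ⬝ᵥ y := fun y hy => hlin M ρ' hρ' hy
    set δ : (κ → 𝕜) → 𝕜 := fun g => P ⬝ᵥ g - (M * D.f g + sc g) with hδ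
    have hdiff : P ⬝ᵥ x - (M * D.f x + sc x) = ∑ g ∈ gens ρ', c g * δ g := by
      rw [hlin' x hxρ', ← sub_dotProduct, ← hcx, dotProduct_sum]
      refine Finset.sum_congr rfl fun g hg => ?_
      rw [dotProduct_smul, smul_eq_mul, sub_dotProduct]
      simp only [hδ, hlin' g (gens_subset hfg' hg)]
    have hδnn : ∀ g ∈ gens ρ', 0 ≤ δ g := fun g hg => by
      have := (hgen ρ hρ g (hgG g hg)).1
      rw [hδ]; linarith
    have hsum_nn : 0 ≤ ∑ g ∈ gens ρ', c g * δ g :=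
      Finset.sum_nonneg fun g hg => mul_nonneg (hc g hg) (hδnn g hg)
    refine ⟨by linarith, ⟨fun heq => ?_, fun hxN => ?_⟩⟩
    · have hxD : x ∈ D.domain (S ρ hρ).anchor := by
        by_contra hxD
        have hex : ∃ g ∈ gens ρ', c g ≠ 0 ∧ g ∉ D.domain (S ρ hρ).anchor := by
          by_contra hall
          push Not at hall
          apply hxD
          rw [← hcx]
          refine Submodule.sum_mem _ fun g hg => ?_
          by_cases hcg : c g = 0
          · rw [hcg, zero_smul]; exact Submodule.zero_mem _
          · exact smul_mem_of_nonneg (hall g hg hcg) (hc g hg)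
        obtain ⟨g, hg, hcg, hgD⟩ := hex
        have hpos : 0 < c g * δ g := by
          refine mul_pos (lt_of_le_of_ne (hc g hg) (Ne.symm hcg)) ?_
          have := (hgen ρ hρ g (hgG g hg)).2 hgD
          rw [hδ]; linarith
        have hsum_pos : 0 < ∑ g ∈ gens ρ', c g * δ g :=
          Finset.sum_pos' (fun g hg => mul_nonneg (hc g hg) (hδnn g hg)) ⟨g, hg, hpos⟩
        linarith
      exact ((hloc M ρ hρ hxD).2).mp heq
    · exact ((hloc M ρ hρ ((S ρ hρ).newDomain_le hxN)).2).mpr hxN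
  -- the support data on the reference subdivision
  let D₀ : Γ.SupportData :=
    { f := fun x => M * D.f x + sc x
      piece := fun ρ => if hρ : ρ ∈ Γ.cones then M • D.piece (S ρ hρ).anchor + (S ρ hρ).expose
        else 0
      eq_piece := fun ρ hρ x hx => by
        simp only [dif_pos hρ]
        exact hlin M ρ hρ hx
      le_piece := fun ρ hρ x hx => by
        simp only [dif_pos hρ]
        exact (hglob ρ hρ hx).1
      exists_domain := fun ρ hρ => by
        refine ⟨(S ρ hρ).newDomain, hnew ρ hρ, fun x => ?_⟩
        simp only [dif_pos hρ]
        constructor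
        · intro hxN
          have hxs : x ∈ Γ.support := Fan.mem_support.mpr ⟨_, hnew ρ hρ, hxN⟩
          exact ⟨hxs, ((hglob ρ hρ hxs).2).mpr hxN⟩
        · rintro ⟨hxs, heq⟩
          exact ((hglob ρ hρ hxs).2).mp heq }
  -- transfer to the given enumeration
  have hsepl : ∀ σ ∈ Δ.cones, ∀ z ∈ l, ∀ z' ∈ l, z ∈ σ → z' ∈ σ → z = z' :=
    fun σ hσ z hz z' hz' => hsep σ hσ z ((hlZ z).1 hz) z' ((hlZ z').1 hz')
  have hcones : (Δ.starIter l).cones = Γ.cones :=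
    Fan.starIter_cones_eq_of_separated hl hl₀nd (fun z => (hlZ z).trans (hl₀Z z).symm) hsepl
  exact ⟨D₀.copy hcones, rfl⟩

end Fan.SupportData

/-! ## Order functions: all cones of `Δ₀` at once -/

namespace Fan

/-- **Multi-point Lemma 2 for order functions** ([KempfEtAl1973] II §2 via charts): if `f` is an
order function for the subdivision `Δ` of `Δ₀` and `Z` is a finite set of nonzero vectors
separated by `Δ`, then for one constant `M > 0` the function `M f + Σ_{z ∈ Z} starCoord_z` is an
order function for the simultaneous star subdivision `Δ.starIter l`, for every duplicate-free
enumeration `l` of `Z`. [cite: KempfEtAl1973, I §2 Thm. 11 proof, Lemma 2] -/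
theorem IsOrdFunction.multiStar {Δ₀ Δ : Fan 𝕜 (κ → 𝕜)} {f : (κ → 𝕜) → 𝕜}
    (h : IsOrdFunction Δ₀ Δ f) {Z : Finset (κ → 𝕜)} (hZ0 : ∀ z ∈ Z, z ≠ 0)
    (hsep : ∀ σ ∈ Δ.cones, ∀ z ∈ Z, ∀ z' ∈ Z, z ∈ σ → z' ∈ σ → z = z') :
    ∃ M : 𝕜, 0 < M ∧ ∀ l : List (κ → 𝕜), l.Nodup → (∀ z, z ∈ l ↔ z ∈ Z) →
      IsOrdFunction Δ₀ (Δ.starIter l) fun x => M * f x + ∑ z ∈ Z, Δ.starCoord z x := by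
  classical
  choose D hDf hsub using h
  -- one bound per cone of `Δ₀`, then one constant for all
  have hsepσ : ∀ {σ} (hσ : σ ∈ Δ₀.cones), ∀ η ∈ (Δ.restrict σ).cones, ∀ z ∈ Z, ∀ z' ∈ Z,
      z ∈ η → z' ∈ η → z = z' := fun hσ η hη => hsep η hη.1
  have hB : ∀ {σ} (hσ : σ ∈ Δ₀.cones), ∃ B : 𝕜, 0 < B ∧ ∀ M : 𝕜, B ≤ M →
      ∀ l : List (κ → 𝕜), l.Nodup → (∀ z, z ∈ l ↔ z ∈ Z) →
        ∃ D' : ((Δ.restrict σ).starIter l).SupportData,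
          D'.f = fun x => M * (D hσ).f x + ∑ z ∈ Z, (Δ.restrict σ).starCoord z x :=
    fun hσ => (D hσ).exists_multiStar hZ0 (hsepσ hσ)
  set T := Δ₀.finite.toFinset with hT
  have hmemT : ∀ {σ}, σ ∈ Δ₀.cones → σ ∈ T := fun hσ => Δ₀.finite.mem_toFinset.mpr hσ
  have hTmem : ∀ {σ}, σ ∈ T → σ ∈ Δ₀.cones := fun hσ => Δ₀.finite.mem_toFinset.mp hσ
  have hB' : ∀ s : T, ∃ B : 𝕜, 0 < B ∧ ∀ M : 𝕜, B ≤ M →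
      ∀ l : List (κ → 𝕜), l.Nodup → (∀ z, z ∈ l ↔ z ∈ Z) →
        ∃ D' : ((Δ.restrict (s : PointedCone 𝕜 (κ → 𝕜))).starIter l).SupportData,
          D'.f = fun x => M * (D (hTmem s.2)).f x +
            ∑ z ∈ Z, (Δ.restrict (s : PointedCone 𝕜 (κ → 𝕜))).starCoord z x :=
    fun s => hB (hTmem s.2)
  choose Bσ hBσpos hBσ using hB'
  set M : 𝕜 := 1 + ∑ s ∈ T.attach, Bσ s with hM
  have hBnn : ∀ s ∈ T.attach, 0 ≤ Bσ s := fun s _ => (hBσpos s).le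
  have hMpos : 0 < M := by
    have := Finset.sum_nonneg hBnn
    rw [hM]; linarith
  have hbig : ∀ {σ} (hσ : σ ∈ Δ₀.cones), Bσ ⟨σ, hmemT hσ⟩ ≤ M := by
    intro σ hσ
    have h1 : Bσ ⟨σ, hmemT hσ⟩ ≤ ∑ s ∈ T.attach, Bσ s :=
      Finset.single_le_sum hBnn (Finset.mem_attach _ _)
    rw [hM]; linarith
  refine ⟨M, hMpos, fun l hl hlZ σ hσ => ?_⟩
  have hl0 : ∀ z ∈ l, z ≠ 0 := fun z hz => hZ0 z ((hlZ z).1 hz)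
  obtain ⟨D', hD'f⟩ := hBσ ⟨σ, hmemT hσ⟩ M (hbig hσ) l hl hlZ
  have hcones : ((Δ.starIter l).restrict σ).cones = ((Δ.restrict σ).starIter l).cones :=
    restrict_starIter_cones l hl0 (hsub hσ)
  have hsuppσ : ((Δ.restrict σ).starIter l).support = (Δ.restrict σ).support :=
    starIter_support_eq l hl0
  have hsupp : ((Δ.starIter l).restrict σ).support = (Δ.restrict σ).support := by
    rw [support_congr hcones, hsuppσ]
  refine ⟨(D'.copy hcones).copyF (fun x => M * f x + ∑ z ∈ Z, Δ.starCoord z x) fun x hx => ?_,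
    rfl, ?_⟩
  · rw [hsupp] at hx
    rw [SupportData.copy_f, hD'f, hDf hσ]
    simp only
    congr 1
    exact Finset.sum_congr rfl fun z hz => (starCoord_restrict_eq (hZ0 z hz) hx).symm
  · rw [hsupp]; exact hsub hσ

/-- The multi-point step preserves non-negativity of the order function (`starCoord ≥ 0`).
[cite: KempfEtAl1973, I §2 Thm. 11 proof (4)] -/
theorem IsOrdFunction.multiStar_nonneg {Δ₀ Δ : Fan 𝕜 (κ → 𝕜)} {f : (κ → 𝕜) → 𝕜}
    (h : IsOrdFunction Δ₀ Δ f) (hnn : ∀ x, 0 ≤ f x) {Z : Finset (κ → 𝕜)} (hZ0 : ∀ z ∈ Z, z ≠ 0)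
    (hsep : ∀ σ ∈ Δ.cones, ∀ z ∈ Z, ∀ z' ∈ Z, z ∈ σ → z' ∈ σ → z = z') :
    ∃ M : 𝕜, 0 < M ∧ (∀ x, 0 ≤ M * f x + ∑ z ∈ Z, Δ.starCoord z x) ∧
      ∀ l : List (κ → 𝕜), l.Nodup → (∀ z, z ∈ l ↔ z ∈ Z) →
        IsOrdFunction Δ₀ (Δ.starIter l) fun x => M * f x + ∑ z ∈ Z, Δ.starCoord z x := by
  obtain ⟨M, hM, hord⟩ := h.multiStar hZ0 hsep
  exact ⟨M, hM, fun x => add_nonneg (mul_nonneg hM.le (hnn x))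
    (Finset.sum_nonneg fun z _ => starCoord_nonneg z x), hord⟩

end Fan

end MultiPoint

end Literature.Geometry.PolyhedralFans

end
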